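import Summits.CriticalPhenomena.CardyFormulaZ2.Theses.CardyBoundaryCoulombGas
import Summits.CriticalPhenomena.CardyFormulaZ2.Theorems.HalfPlaneOneArmThird.Negative.EventForms
import Literature.Probability.Percolation.QuadCrossingRotationInvariance
import Literature.Probability.Percolation.IkhlefPonsaingFirstPassage

/-!
# Line `ip-passage-stirling` for crux `CardyBoundaryCoulombGas.HalfPlaneOneArmThird`
(stmt-CriticalPhenomena-5662; shared verbatim with `CardyTotalPositivity.HalfPlaneOneArmThird`)

Crux-plan skeleton (planner `planner-cruxplan-stmt-CriticalPhenomena-5662-ip-passage-stirling-0`,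
round 1, 2026-08-16; idea card `Cruxes/HalfPlaneOneArmThird/Ideas/ip-passage-stirling.md`
(ideator 3), triage `TRIAGE-r1-{1,2,3}.md`: pass × 3; line card `Lines/ip-passage-stirling.md`).

THE CRUX. `HalfPlaneOneArmThird`: for bond percolation on `ℤ²` at `p = 1/2`,
`log π⁺(n) / log n → -1/3`, where `π⁺(n) = P[0 ↔ {y₀ = ±n} ∪ {y₁ = n} inside [-n,n]×[0,n]]` is the
half-plane one-arm probability to sup-distance `n` (axis half-plane `{v₁ ≥ 0}`, `0` on the boundary
row). Open problem on `ℤ²` (known on site-`𝕋` only, Smirnov–Werner 2001 Thm 3).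

THE LINE (Ikhlef–Ponsaing wall passage → Gamma-ratio asymptotics → matched-scale RSW dictionary →
DKKMO rotation). Write `s = v₀ + v₁`, `d = v₀ - v₁` (the DIAGONAL coordinates of `ℤ²`: the
Temperley–Lieb(loop weight 1) / Razumov–Stroganov transfer matrix of bond percolation on `ℤ²` at
`p = 1/2` propagates along `s`).
* `P_b(2m+1) := P[(2m, 0) ↔ the row {s = 0} inside the diagonal strip {0 ≤ s ≤ 2m+1}]`
  (`wallPassage m`): the wired/free strip of medial width `L = 2m+1` of Ikhlef–Ponsaing
  (arXiv:1202.5476, Def. 4.1), the site one row inside the free wall `{s = 2m+1}`, the wall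
  `{s = 0}` wired. IP Prop. 4.7 (qKZ solution of the stochastic TL(1) transfer matrix + symmetry /
  recursion / degree + Okada-type symplectic character evaluations) gives the CLOSED FORM
  `P_b(2m+1) = A_V(2m+1) A_V(2m+3) / N_8(2m+2)²` with `A_V(2m+1) = ∏_{i<m} (3i+2)(6i+3)!(2i+1)!/((4i+2)!(4i+3)!)`
  (vertically symmetric ASMs: 1, 1, 3, 26, 646, …) and `N_8(2m) = ∏_{i<m} (3i+1)(6i)!(2i)!/((4i)!(4i+1)!)`
  (CSSCPPs: 1, 1, 2, 11, 170, …); dictionary P_b = percolation probability verified digit-for-digit at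
  `L = 3, 5, 7` by exact rational transfer matrices (`DictionaryChecksIdeatorThree.md`: 3/4, 78/121,
  247/425; and 147/256, 507/1024, 183027/409600 for the companion `P̂_b`). Dividing consecutive
  values, the closed form is EQUIVALENT (given the trivial `P_b(1) = 1`, proved below as
  `wallPassage_zero`) to the two-step RECURSION
  `P_b(2m+3) · (3m+4)(4m+7)(6m+5) = P_b(2m+1) · (3m+5)(4m+3)(6m+7)`   (all `m ≥ 0`)       — stub S1,
  i.e. `P_b(2m+1) = const · Γ(m+5/3)Γ(m+3/4)Γ(m+7/6) / (Γ(m+4/3)Γ(m+7/4)Γ(m+5/6))`, whence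
  `(5/3+3/4+7/6) - (4/3+7/4+5/6) = -1/3`: `log P_b(2m+1) / log m → -1/3` (IP Prop. 4.9 even gives
  `(2m+1)^{1/3} P_b(2m+1) → C = 9·2^{-5/3}Γ(1/3)Γ(5/6)/(Γ(1/6)Γ(2/3)) ≈ 1.1373`; the crux needs only
  the exponent, and EXISTENCE of the limit comes for free)                                   — stub S2.
* Matched-scale dictionary with the diagonal half-plane one-arm probability
  `π◇(n) := P[0 ↔ {s = -n} ∪ {d = ±n} inside {s ≤ 1, s ≥ -n, |d| ≤ n}]` (`diagArm n`; free boundary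
  row `{s = 1}`, the origin one row inside — IP's position; the box is the DIAMOND of radius `n`, the
  natural box of the diagonal lattice and the shape of DKKMO's rotated quads): translating `(2n,0) ↦ 0`
  the strip becomes `{-2n ≤ s ≤ 1}` with wired row `{s = -2n}`, so
  `P_b(2n+1) ≤ π◇(n)` (first exit from the diamond, a.s. inclusion)                          — stub S3,
  `c · π◇(n) ≤ P_b(2n+1)` (Harris–FKG gluing: an open half-circuit in the diamond half-annulus
  `{n/2 ≤ radius ≤ n} ∩ {s ≤ 1}` and an open `s`-crossing of `{-2n ≤ s ≤ 1, |d| ≤ n/2}` down to the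
  wired row, both of RSW-probability `≥ c₀` uniformly in `n`; lattice paths that cross share a vertex)
                                                                                             — stub S4.
  Both at the SAME scale, so `log π◇(n) = log P_b(2n+1) + O(1)`: no quasi-multiplicativity and no
  ratio limit is needed on the diagonal side, and `log π◇(n)/log n → -1/3` INCLUDING existence.
* Orientation transfer `(log π◇(n) - log π⁺(n)) / log n → 0`                                — stub S5,
  from Duminil-Copin–Kozlowski–Krachun–Manolescu–Oulamara 2020, Cor. 1.3 at `q = 1` (tree NAMED FACT
  `Literature.Probability.Percolation.dkkmo_crossing_rotation_invariance`, per quad) applied to the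
  half-annulus quads `Q_λ = {1 ≤ |z|_∞ ≤ λ, Im z ≥ 0}` (corners `λ, -λ, -1, 1`) at angle `π/4` (plus the
  lattice symmetries of `ℤ²` relating the four diagonal half-planes and integer translations), along
  `n = λ^k`: per-block crossing probabilities of the two orientations agree up to `1 + o(1)` (DKKMO +
  RSW lower bound `c(λ)`), and one-arm quasi-multiplicativity in EACH orientation holds with
  λ-INDEPENDENT constants (FKG gluing through half-circuits, independence of disjoint blocks), so
  `limsup |log π◇(n) - log π⁺(n)| / log n ≤ 2 log(1/c₀²c₁) / log λ` for every `λ`, i.e. `= 0`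
  (TRIAGE-r1-2 F1, TRIAGE-r1-3 [T], TRIAGE-r1-1 "Two facts"). Because a cite-tagged Literature fact
  is not an admissible hypothesis of a crux proof, the fact itself is the explicit external debt of
  the line                                                                                   — stub S6
  (`stub_dkkmoRotationInvariance : dkkmo_crossing_rotation_invariance`, a PUBLISHED theorem,
  arXiv:2012.11672 Cor. 1.3; to be discharged by proving the vendored fact, never by assuming it).
* Composition `HalfPlaneOneArmThird_of` (kernel-checked below, no `sorry`): S1+S2 ⇒
  `log P_b(2n+1)/log n → -1/3` (and `P_b > 0` by the recursion from `P_b(1) = 1`); S3+S4 ⇒ sandwich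
  `log P_b(2n+1) ≤ log π◇(n) ≤ log P_b(2n+1) - log c` ⇒ `log π◇(n)/log n → -1/3`; S5(S6) ⇒ subtract
  an `o(1)` ⇒ the crux, concluded BY NAME.

REGISTERED STUBS (the only `sorry`s; each stated over TREE VOCABULARY ONLY — `bondPercolation`,
`zdGraph`, `half`, `Site`, `openConnIn`, `dkkmo_crossing_rotation_invariance`, Mathlib — so that each
lands verbatim as `Summits/CriticalPhenomena/CardyFormulaZ2/Theorems/<Name>.lean --supports
stmt-CriticalPhenomena-5662`; helper files copy the `open` lines below and the statement
byte-for-byte; the named `def`s of §Vocabulary / §Named statements are READABLE COPIES, certified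
equal to the stubs by the `*_holds` theorems, and `Registered.stub_*` are the name-keyed aliases the
native skeleton audit admits as hypotheses of `HalfPlaneOneArmThird_of` — device of
`Cruxes/StripClusterRates/Lines/two-cluster-rate-is-stationary-gap.lean`):
* `stub_ipRecursion`             (S1, XL / research: IP 2012 Props 4.1–4.7 made theorems — HARDEST);
* `stub_recursionExponent`       (S2, M: Gamma-ratio / Stirling asymptotics of an explicit recursion);
* `stub_passageLeArm`            (S3, M: translation + first exit);
* `stub_armLePassage`            (S4, L: RSW/FKG gluing in the diagonal geometry);
* `stub_rotationTransfer`        (S5, L/XL: DKKMO fact ⇒ exponent transfer; quads, continuum ↔ lattice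
                                  crossings, quasi-multiplicativity in two orientations);
* `stub_dkkmoRotationInvariance` (S6, published theorem = the tree's named fact; external debt).

LEAD RESHAPE r1 (prover-line-stmt-CriticalPhenomena-5662-0, 2026-08-16): the tree already carries
IP 2012 Prop. 4.7 as the named fact `Literature.Probability.Percolation.IkhlefPonsaingFirstPassage`
(vendored 2026-08-15 for crux EdgePrecompact; same event as `wallPassage m` at `b = (2m, 0)` up to the
cast `((2m+1 : ℕ) : ℤ) = 2m+1`). S1 is therefore split, exactly like S5/S6, into the PROVABLE bridge
* `stub_ipRecursion_of_ikhlefPonsaing` (S1a, M: the fact's factorial products ⇒ the two-step recursion,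
  pure algebra `A_V(2m+5)/A_V(2m+1) · (N_8(2m+2)/N_8(2m+4))² = ρ(m)`), and the external debt
* `stub_ikhlefPonsaingFirstPassage` (S1b = the named fact itself, XL: IP Props 4.1–4.7 as theorems).
The composition now takes seven registered stubs; `stub_ipRecursion` survives as the derived theorem
`ipRecursion_of_stubs` (no longer a stub).

DISPROOF USED (`Cruxes/HalfPlaneOneArmThird/Disproof.lean`, cdisprove v2, NO KILL; landed as
`Theorems/HalfPlaneOneArmThird/Negative/{Basics,Window,ParameterPinned,EventForms}.lean`, imported here
so the scratch check sees them). There is no `_false_without_<H>` theorem by that name; the operative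
finding is `Negative.crux_false_of_ne_half` (the statement is FALSE at every `p ≠ 1/2`, so a proof must
use criticality from both sides): honoured at S1 (the closed form / recursion is an identity of the
`p = 1/2` model only — loop weight `n = 1` is what makes the TL transfer matrix STOCHASTIC and its Perron
vector the qKZ vector), at S4 and S5 (RSW/FKG at the self-dual point: Harris side and sharpness side).
`Negative.exponentAt_half_window` (`α₀ ≤ β ≤ 1`): the value produced here, `1/3`, is interior —
consistent. `Negative.prob_eq_far` (half-box arm = half-plane arm to distance `n`): the same first-exit
pattern proves S3. No stub is an instance of a landed Negative lemma (none concerns `p ≠ 1/2`; none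
restates `HalfPlaneOneArmThird`, `ExponentAt`, or a window bound). Negatives index (CardyFormulaZ2:
stmt-0748, stmt-6949): no contact.
-/

noncomputable section

namespace Summit.CriticalPhenomena.CardyFormulaZ2.Cruxes.HalfPlaneOneArmThird.IpPassageStirling

open Filter Topology
open Literature.Probability.Percolation Literature.Probability.LatticeModels

/-! ## Vocabulary (readable local names; the registered stubs inline all of them) -/

/-- `P_b(2m+1)` — Ikhlef–Ponsaing's wall passage probability (arXiv:1202.5476 Def. 4.1 / Prop. 4.7)
as a bond-percolation probability on `ℤ²` at `p = 1/2`: the site `(2m, 0)` (diagonal height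
`s = 2m`, one row inside the free wall `{s = 2m+1}`) is joined INSIDE the diagonal strip
`{0 ≤ v₀+v₁ ≤ 2m+1}` to some site of the wired row `{v₀+v₁ = 0}`. Values: `1, 3/4, 78/121, 247/425,
210/391, …` for `m = 0, 1, 2, 3, 4`. -/
def wallPassage (m : ℕ) : ℝ :=
  (bondPercolation (zdGraph 2) half).real
    {ω | ∃ y : Site 2, y 0 + y 1 = 0 ∧
      ω ∈ openConnIn {v : Site 2 | 0 ≤ v 0 + v 1 ∧ v 0 + v 1 ≤ 2 * (m : ℤ) + 1} ![2 * (m : ℤ), 0] y}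

/-- Numerator of IP's two-step ratio `ρ(m) = P_b(2m+3)/P_b(2m+1) = (3m+5)(4m+3)(6m+7)/((3m+4)(4m+7)(6m+5))`
(from `A_V(2m+5)/A_V(2m+1) · (N_8(2m+2)/N_8(2m+4))²`; `ρ(0) = 3/4`, `ρ(1) = 104/121`, `ρ(2) = 2299/2550`). -/
def recNum (m : ℕ) : ℝ := (3 * (m : ℝ) + 5) * (4 * (m : ℝ) + 3) * (6 * (m : ℝ) + 7)

/-- Denominator of IP's two-step ratio `ρ(m)` (see `recNum`). -/
def recDen (m : ℕ) : ℝ := (3 * (m : ℝ) + 4) * (4 * (m : ℝ) + 7) * (6 * (m : ℝ) + 5)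

/-- `π◇(n)` — the DIAGONAL half-plane one-arm probability at scale `n`: in the half-plane
`{v₀+v₁ ≤ 1}` (free boundary row `{s = 1}`, the origin one row inside, as IP's site), the origin is
joined inside the diamond `{-n ≤ v₀+v₁ ≤ 1, |v₀-v₁| ≤ n}` to its outer boundary
`{v₀+v₁ = -n} ∪ {v₀-v₁ = n} ∪ {v₀-v₁ = -n}`. -/
def diagArm (n : ℕ) : ℝ :=
  (bondPercolation (zdGraph 2) half).real
    {ω | ∃ y : Site 2, (y 0 + y 1 = -(n : ℤ) ∨ y 0 - y 1 = (n : ℤ) ∨ y 0 - y 1 = -(n : ℤ)) ∧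
      ω ∈ openConnIn {v : Site 2 | v 0 + v 1 ≤ 1 ∧ -(n : ℤ) ≤ v 0 + v 1 ∧
        -(n : ℤ) ≤ v 0 - v 1 ∧ v 0 - v 1 ≤ n} 0 y}

/-- `π⁺(n)` — the crux's AXIS half-plane one-arm probability, VERBATIM the probability inside
`CardyBoundaryCoulombGas.HalfPlaneOneArmThird`: `0 ↔ {y₀ = n} ∪ {y₀ = -n} ∪ {y₁ = n}` inside the
half-box `[-n, n] × [0, n]`. -/
def axisArm (n : ℕ) : ℝ :=
  (bondPercolation (zdGraph 2) half).real
    {ω | ∃ y : Site 2, (y 0 = (n : ℤ) ∨ y 0 = -(n : ℤ) ∨ y 1 = (n : ℤ)) ∧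
      ω ∈ openConnIn {v : Site 2 | 0 ≤ v 1 ∧ -(n : ℤ) ≤ v 0 ∧ v 0 ≤ n ∧ v 1 ≤ n} 0 y}

/-- The crux, read through `axisArm`: it is `log π⁺(n) / log n → -1/3` on the nose. -/
theorem crux_iff_axisArm :
    Summit.CriticalPhenomena.CardyFormulaZ2.Theses.CardyBoundaryCoulombGas.HalfPlaneOneArmThird ↔
      Tendsto (fun n : ℕ ↦ Real.log (axisArm n) / Real.log n) atTop (𝓝 (-(1 / 3 : ℝ))) :=
  Iff.rfl

/-- `π⁺(n)` is the cdisprove file's `Negative.prob half n` (same event), so the landed Negative lemmas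
(`prob_pos`, `prob_eq_far`, the window) speak about `axisArm`. -/
theorem axisArm_eq_negativeProb (n : ℕ) :
    axisArm n = Summit.CriticalPhenomena.CardyFormulaZ2.Theorems.HalfPlaneOneArmThird.Negative.prob half n :=
  rfl

/-! ## Named statements (readable copies of the six stubs) -/

/-- **S1 (IP closed form, recursion form).** `P_b(2m+3)·(3m+4)(4m+7)(6m+5) = P_b(2m+1)·(3m+5)(4m+3)(6m+7)`
for all `m ≥ 0` — equivalent, given `P_b(1) = 1` (`wallPassage_zero`), to Ikhlef–Ponsaing Prop. 4.7
`P_b(L) = A_V(L)A_V(L+2)/N_8(L+1)²` (`L = 2m+1`). -/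
def IPRecursion : Prop := ∀ m : ℕ, wallPassage (m + 1) * recDen m = wallPassage m * recNum m

/-- **S1a (bridge).** The tree's named fact `IkhlefPonsaingFirstPassage` (IP Prop. 4.7, closed form
with explicit factorial products) implies the recursion `IPRecursion`. -/
def IPRecursionOfFact : Prop :=
  Literature.Probability.Percolation.IkhlefPonsaingFirstPassage → IPRecursion

/-- **S1b (external debt).** The named fact `IkhlefPonsaingFirstPassage` itself. -/
def IPFirstPassage : Prop := Literature.Probability.Percolation.IkhlefPonsaingFirstPassage

/-- **S2 (Gamma-ratio / Stirling asymptotics of the recursion).** Any real sequence with `u 0 = 1`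
obeying S1's recursion has `log u(m) / log m → -1/3` (it is
`const·Γ(m+5/3)Γ(m+3/4)Γ(m+7/6)/(Γ(m+4/3)Γ(m+7/4)Γ(m+5/6)) ~ C'·m^{-1/3}`). Pure real analysis. -/
def RecursionExponent : Prop :=
  ∀ u : ℕ → ℝ, u 0 = 1 → (∀ m : ℕ, u (m + 1) * recDen m = u m * recNum m) →
    Tendsto (fun m : ℕ ↦ Real.log (u m) / Real.log m) atTop (𝓝 (-(1 / 3 : ℝ)))

/-- **S3 (dictionary, inclusion half).** `P_b(2n+1) ≤ π◇(n)` for `n ≥ 1`: translate `(2n,0) ↦ 0`; an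
open path from `0` to the wired row `{s = -2n}` inside `{-2n ≤ s ≤ 1}` leaves the diamond of radius `n`
through its outer boundary (first exit; steps change `s` and `d` by `±1`). -/
def PassageLeArm : Prop := ∀ n : ℕ, 1 ≤ n → wallPassage n ≤ diagArm n

/-- **S4 (dictionary, RSW half).** `c · π◇(n) ≤ P_b(2n+1)` for `n ≥ 1` with `c > 0` absolute:
Harris–FKG with an open half-circuit of the diamond half-annulus `{n/2 ≤ radius ≤ n} ∩ {s ≤ 1}` and an
open `s`-crossing of `{-2n ≤ s ≤ 1, |d| ≤ n/2}` (RSW in the diagonal geometry, from axis RSW by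
staircases), lattice paths that cross share a vertex. -/
def ArmLePassage : Prop := ∃ c : ℝ, 0 < c ∧ ∀ n : ℕ, 1 ≤ n → c * diagArm n ≤ wallPassage n

/-- **S5 (orientation transfer at exponent level, from the DKKMO fact).**
`(log π◇(n) - log π⁺(n)) / log n → 0` assuming `dkkmo_crossing_rotation_invariance` (DKKMO 2020
Cor. 1.3 at `q = 1`, per quad): half-annulus quads at angle `π/4`, per-block probabilities equal up to
`1 + o(1)`, one-arm quasi-multiplicativity in both orientations with scale-free constants, every `λ`. -/
def RotationTransfer : Prop :=
  dkkmo_crossing_rotation_invariance →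
    Tendsto (fun n : ℕ ↦ (Real.log (diagArm n) - Real.log (axisArm n)) / Real.log n) atTop (𝓝 0)

/-- **S6 (external debt).** The tree's named fact `dkkmo_crossing_rotation_invariance`
(Duminil-Copin–Kozlowski–Krachun–Manolescu–Oulamara, arXiv:2012.11672, Cor. 1.3, `q = 1`), a
PUBLISHED theorem vendored unproved; a cite-tagged fact is not an admissible hypothesis of a crux
proof, so proving (formalising) it is an explicit obligation of the line. -/
def DKKMORotationInvariance : Prop := dkkmo_crossing_rotation_invariance

/-! ## Registered stubs (the ONLY admitted steps; statements = the named `def`s with `wallPassage`,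
`recNum`, `recDen`, `diagArm`, `axisArm` inlined over tree vocabulary) -/

/-- **S1a (bridge)** `= IPRecursionOfFact` verbatim: Ikhlef–Ponsaing Prop. 4.7, in the tree's
named-fact form `IkhlefPonsaingFirstPassage` (closed form with the three factorial products
`A_V(2m+1)`, `A_V(2m+3)`, `N_8(2m+2)` written out), implies the two-step recursion
`P_b(2m+3)·(3m+4)(4m+7)(6m+5) = P_b(2m+1)·(3m+5)(4m+3)(6m+7)` (specialise the fact at `b = (2m, 0)`
and `b = (2m+2, 0)`, divide: `A_V(2m+5)/A_V(2m+1) · (N_8(2m+2)/N_8(2m+4))² = ρ(m)`, a finite product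
identity of factorials). Size M, pure algebra; provable now. -/
theorem stub_ipRecursion_of_ikhlefPonsaing :
    Literature.Probability.Percolation.IkhlefPonsaingFirstPassage →
    ∀ m : ℕ,
      (bondPercolation (zdGraph 2) half).real
          {ω | ∃ y : Site 2, y 0 + y 1 = 0 ∧
            ω ∈ openConnIn {v : Site 2 | 0 ≤ v 0 + v 1 ∧ v 0 + v 1 ≤ 2 * ((m + 1 : ℕ) : ℤ) + 1}
              ![2 * ((m + 1 : ℕ) : ℤ), 0] y} *
        ((3 * (m : ℝ) + 4) * (4 * (m : ℝ) + 7) * (6 * (m : ℝ) + 5)) =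
      (bondPercolation (zdGraph 2) half).real
          {ω | ∃ y : Site 2, y 0 + y 1 = 0 ∧
            ω ∈ openConnIn {v : Site 2 | 0 ≤ v 0 + v 1 ∧ v 0 + v 1 ≤ 2 * (m : ℤ) + 1}
              ![2 * (m : ℤ), 0] y} *
        ((3 * (m : ℝ) + 5) * (4 * (m : ℝ) + 3) * (6 * (m : ℝ) + 7)) := by
  sorry

/-- **S1b (external debt)** `= IPFirstPassage`: the tree's named fact
`Literature.Probability.Percolation.IkhlefPonsaingFirstPassage` itself (Ikhlef–Ponsaing, J. Stat.
Phys. 149 (2012), arXiv:1202.5476, Prop. 4.7: stochastic TL(1) strip transfer matrix ↔ percolation in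
the diagonal wired/free strip; its Perron vector = the polynomial qKZ solution at `q = e^{2πi/3}`;
symmetry + recursion + degree ⇒ symplectic characters; homogeneous limit ⇒ `A_V`, `N_8`; rigour
template Hagendorf–Liénardy arXiv:2008.03220). A PUBLISHED result vendored unproved; discharge by
proving the fact (`IkhlefPonsaingFirstPassage_holds` in Literature), never by assuming it.
Size XL / research. HARDEST. -/
theorem stub_ikhlefPonsaingFirstPassage :
    Literature.Probability.Percolation.IkhlefPonsaingFirstPassage := by
  sorry

/-- **S2** `= RecursionExponent` verbatim. Size M (e.g. `log ρ(k) = -1/(3k) + O(k⁻²)` summed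
against the harmonic series, or Mathlib's `Real.Gamma` asymptotics). -/
theorem stub_recursionExponent :
    ∀ u : ℕ → ℝ, u 0 = 1 →
      (∀ m : ℕ, u (m + 1) * ((3 * (m : ℝ) + 4) * (4 * (m : ℝ) + 7) * (6 * (m : ℝ) + 5)) =
        u m * ((3 * (m : ℝ) + 5) * (4 * (m : ℝ) + 3) * (6 * (m : ℝ) + 7))) →
      Tendsto (fun m : ℕ ↦ Real.log (u m) / Real.log m) atTop (𝓝 (-(1 / 3 : ℝ))) := by
  sorry

/-- **S3** `= PassageLeArm` verbatim. Size M (translation invariance of `bondPercolation (zdGraph 2)`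
under `v ↦ v - (2n, 0)`, e.g. `real_openCrossing_shift` / `bondPercolation_real_image`; first exit
as in `Negative.mem_armEvt_of_far`; a.s. `ω ⊆ E(ℤ²)` by `ae_subset_edgeSet`). -/
theorem stub_passageLeArm :
    ∀ n : ℕ, 1 ≤ n →
      (bondPercolation (zdGraph 2) half).real
          {ω | ∃ y : Site 2, y 0 + y 1 = 0 ∧
            ω ∈ openConnIn {v : Site 2 | 0 ≤ v 0 + v 1 ∧ v 0 + v 1 ≤ 2 * (n : ℤ) + 1}
              ![2 * (n : ℤ), 0] y} ≤
      (bondPercolation (zdGraph 2) half).real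
          {ω | ∃ y : Site 2, (y 0 + y 1 = -(n : ℤ) ∨ y 0 - y 1 = (n : ℤ) ∨ y 0 - y 1 = -(n : ℤ)) ∧
            ω ∈ openConnIn {v : Site 2 | v 0 + v 1 ≤ 1 ∧ -(n : ℤ) ≤ v 0 + v 1 ∧
              -(n : ℤ) ≤ v 0 - v 1 ∧ v 0 - v 1 ≤ n} 0 y} := by
  sorry

/-- **S4** `= ArmLePassage` verbatim. Size L (`harris_fkg_holds`, RSW `crossingProb_half_succ_self_holds`
transported to diagonal rectangles by FKG-glued staircases of axis rectangles,
`exists_mem_support_of_crossing` for "crossing lattice paths meet"). -/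
theorem stub_armLePassage :
    ∃ c : ℝ, 0 < c ∧ ∀ n : ℕ, 1 ≤ n →
      c * (bondPercolation (zdGraph 2) half).real
          {ω | ∃ y : Site 2, (y 0 + y 1 = -(n : ℤ) ∨ y 0 - y 1 = (n : ℤ) ∨ y 0 - y 1 = -(n : ℤ)) ∧
            ω ∈ openConnIn {v : Site 2 | v 0 + v 1 ≤ 1 ∧ -(n : ℤ) ≤ v 0 + v 1 ∧
              -(n : ℤ) ≤ v 0 - v 1 ∧ v 0 - v 1 ≤ n} 0 y} ≤
      (bondPercolation (zdGraph 2) half).real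
          {ω | ∃ y : Site 2, y 0 + y 1 = 0 ∧
            ω ∈ openConnIn {v : Site 2 | 0 ≤ v 0 + v 1 ∧ v 0 + v 1 ≤ 2 * (n : ℤ) + 1}
              ![2 * (n : ℤ), 0] y} := by
  sorry

/-- **S5** `= RotationTransfer` verbatim. Size L/XL (the half-annulus quads
`{1 ≤ |z|_∞ ≤ λ, Im z ≥ 0}` as `ConformalRectangle`s and their `rotateQuad (π/4)` images; the
Schramm–Smirnov event `quadCrossing` ↔ lattice crossings `openConnIn` of the discrete half-annuli in
both orientations; lattice symmetries of `ℤ²` between the four diagonal half-planes; RSW/FKG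
quasi-multiplicativity of `axisArm`, `diagArm` along `λ^k` with `λ`-free constants; `λ → ∞`). -/
theorem stub_rotationTransfer :
    dkkmo_crossing_rotation_invariance →
      Tendsto (fun n : ℕ ↦
        (Real.log ((bondPercolation (zdGraph 2) half).real
            {ω | ∃ y : Site 2, (y 0 + y 1 = -(n : ℤ) ∨ y 0 - y 1 = (n : ℤ) ∨ y 0 - y 1 = -(n : ℤ)) ∧
              ω ∈ openConnIn {v : Site 2 | v 0 + v 1 ≤ 1 ∧ -(n : ℤ) ≤ v 0 + v 1 ∧
                -(n : ℤ) ≤ v 0 - v 1 ∧ v 0 - v 1 ≤ n} 0 y}) -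
          Real.log ((bondPercolation (zdGraph 2) half).real
            {ω | ∃ y : Site 2, (y 0 = (n : ℤ) ∨ y 0 = -(n : ℤ) ∨ y 1 = (n : ℤ)) ∧
              ω ∈ openConnIn {v : Site 2 | 0 ≤ v 1 ∧ -(n : ℤ) ≤ v 0 ∧ v 0 ≤ n ∧ v 1 ≤ n} 0 y})) /
          Real.log n) atTop (𝓝 0) := by
  sorry

/-- **S6** `= DKKMORotationInvariance`: the named fact itself (DKKMO arXiv:2012.11672 Cor. 1.3 at
`q = 1`, `Literature/Probability/Percolation/QuadCrossingRotationInvariance.lean`). External debt of the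
line: discharge by PROVING the vendored fact (a fact proof in Literature), never by assuming it. -/
theorem stub_dkkmoRotationInvariance : dkkmo_crossing_rotation_invariance := by
  sorry

/-! ### Consistency: each named statement IS its registered stub (definitionally) -/

theorem ipRecursionOfFact_holds : IPRecursionOfFact := fun h m => stub_ipRecursion_of_ikhlefPonsaing h m
theorem ipFirstPassage_holds : IPFirstPassage := stub_ikhlefPonsaingFirstPassage
/-- S1 (the former registered stub `stub_ipRecursion`), now DERIVED from S1a + S1b. -/
theorem ipRecursion_of_stubs : IPRecursion := ipRecursionOfFact_holds ipFirstPassage_holds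
theorem recursionExponent_holds : RecursionExponent := fun u h0 h => stub_recursionExponent u h0 h
theorem passageLeArm_holds : PassageLeArm := fun n hn => stub_passageLeArm n hn
theorem armLePassage_holds : ArmLePassage := stub_armLePassage
theorem rotationTransfer_holds : RotationTransfer := fun h => stub_rotationTransfer h
theorem dkkmoRotationInvariance_holds : DKKMORotationInvariance := stub_dkkmoRotationInvariance

/-! ### Name-keyed aliases of the six statements (the hypotheses of the composition) -/
namespace Registered

/-- Alias of `IPRecursionOfFact` keyed by the registered stub name. -/
abbrev stub_ipRecursion_of_ikhlefPonsaing : Prop := IPRecursionOfFact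
/-- Alias of `IPFirstPassage` keyed by the registered stub name. -/
abbrev stub_ikhlefPonsaingFirstPassage : Prop := IPFirstPassage
/-- Alias of `RecursionExponent` keyed by the registered stub name. -/
abbrev stub_recursionExponent : Prop := RecursionExponent
/-- Alias of `PassageLeArm` keyed by the registered stub name. -/
abbrev stub_passageLeArm : Prop := PassageLeArm
/-- Alias of `ArmLePassage` keyed by the registered stub name. -/
abbrev stub_armLePassage : Prop := ArmLePassage
/-- Alias of `RotationTransfer` keyed by the registered stub name. -/
abbrev stub_rotationTransfer : Prop := RotationTransfer
/-- Alias of `DKKMORotationInvariance` keyed by the registered stub name. -/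
abbrev stub_dkkmoRotationInvariance : Prop := DKKMORotationInvariance

end Registered

/-! ## Proved glue (kernel-checked; nothing is admitted below this line) -/

/-- `P_b(1) = 1`: for `m = 0` the site `(0,0)` lies on the wired row itself. -/
theorem wallPassage_zero : wallPassage 0 = 1 := by
  have hmem : (![2 * ((0 : ℕ) : ℤ), 0] : Site 2) ∈
      {v : Site 2 | 0 ≤ v 0 + v 1 ∧ v 0 + v 1 ≤ 2 * ((0 : ℕ) : ℤ) + 1} := by
    simp
  unfold wallPassage
  convert MeasureTheory.probReal_univ (μ := bondPercolation (zdGraph 2) half) using 2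
  refine Set.eq_univ_of_forall fun ω => ⟨![2 * ((0 : ℕ) : ℤ), 0], by simp, ?_⟩
  exact ⟨hmem, hmem, SimpleGraph.Reachable.refl _⟩

/-- The recursion coefficients are positive. -/
theorem recNum_pos (m : ℕ) : 0 < recNum m := by
  unfold recNum; positivity

/-- The recursion coefficients are positive. -/
theorem recDen_pos (m : ℕ) : 0 < recDen m := by
  unfold recDen; positivity

/-- From S1 and `P_b(1) = 1`: every `P_b(2m+1)` is positive. -/
theorem wallPassage_pos (h₁ : IPRecursion) (m : ℕ) : 0 < wallPassage m := by
  induction m with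
  | zero => rw [wallPassage_zero]; exact one_pos
  | succ m ih =>
    have hD := recDen_pos m
    have hN := recNum_pos m
    have h := h₁ m
    have hprod : 0 < wallPassage (m + 1) * recDen m := by
      rw [h]; exact mul_pos ih hN
    exact (mul_pos_iff_of_pos_right hD).mp hprod

/-- `log n → +∞` along the naturals, and `K / log n → 0`. -/
theorem tendsto_const_div_log (K : ℝ) :
    Tendsto (fun n : ℕ ↦ K / Real.log n) atTop (𝓝 0) :=
  tendsto_const_nhds.div_atTop (Real.tendsto_log_atTop.comp tendsto_natCast_atTop_atTop)

/-- **Composition.** The seven registered stubs imply the crux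
`CardyBoundaryCoulombGas.HalfPlaneOneArmThird`, concluded BY NAME:
S1a+S1b give S1 (the recursion); S1+S2 give `log P_b(2n+1)/log n → -1/3`; S3+S4 sandwich `log π◇(n)` between `log P_b(2n+1)` and
`log P_b(2n+1) - log c`; S5 (fed with S6) removes the orientation: `log π⁺(n)/log n → -1/3`. -/
theorem HalfPlaneOneArmThird_of (h₁ : Registered.stub_ipRecursion_of_ikhlefPonsaing)
    (h₁' : Registered.stub_ikhlefPonsaingFirstPassage) (h₂ : Registered.stub_recursionExponent) (h₃ : Registered.stub_passageLeArm)
    (h₄ : Registered.stub_armLePassage) (h₅ : Registered.stub_rotationTransfer)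
    (h₆ : Registered.stub_dkkmoRotationInvariance) :
    Summit.CriticalPhenomena.CardyFormulaZ2.Theses.CardyBoundaryCoulombGas.HalfPlaneOneArmThird := by
  refine crux_iff_axisArm.mpr ?_
  have hIP : IPRecursion := h₁ h₁'
  have hwpos : ∀ m : ℕ, 0 < wallPassage m := wallPassage_pos hIP
  -- Step A: the exponent of the wall passage probability (S1 + S2)
  have hA : Tendsto (fun n : ℕ ↦ Real.log (wallPassage n) / Real.log n) atTop (𝓝 (-(1 / 3 : ℝ))) :=
    h₂ wallPassage wallPassage_zero hIP
  -- Step B: the diagonal half-plane exponent by the matched-scale sandwich (S3 + S4)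
  obtain ⟨c, hc, h₄'⟩ := h₄
  have hup : Tendsto (fun n : ℕ ↦ (Real.log (wallPassage n) - Real.log c) / Real.log n) atTop
      (𝓝 (-(1 / 3 : ℝ))) := by
    have h := hA.sub (tendsto_const_div_log (Real.log c))
    rw [sub_zero] at h
    refine h.congr' (Eventually.of_forall fun n => ?_)
    simp only [sub_div]
  have hB : Tendsto (fun n : ℕ ↦ Real.log (diagArm n) / Real.log n) atTop (𝓝 (-(1 / 3 : ℝ))) := by
    refine tendsto_of_tendsto_of_tendsto_of_le_of_le' hA hup ?_ ?_
    · filter_upwards [eventually_ge_atTop 2] with n hn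
      have hn' : (2 : ℝ) ≤ n := by exact_mod_cast hn
      have hlog : 0 < Real.log n := Real.log_pos (by linarith)
      have hle : wallPassage n ≤ diagArm n := h₃ n (by omega)
      exact div_le_div_of_nonneg_right (Real.log_le_log (hwpos n) hle) hlog.le
    · filter_upwards [eventually_ge_atTop 2] with n hn
      have hn' : (2 : ℝ) ≤ n := by exact_mod_cast hn
      have hlog : 0 < Real.log n := Real.log_pos (by linarith)
      have hle : c * diagArm n ≤ wallPassage n := h₄' n (by omega)
      have hdpos : 0 < diagArm n := lt_of_lt_of_le (hwpos n) (h₃ n (by omega))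
      have hle' : diagArm n ≤ wallPassage n / c := by
        rw [le_div_iff₀ hc, mul_comm]; exact hle
      have hlogle := Real.log_le_log hdpos hle'
      rw [Real.log_div (hwpos n).ne' hc.ne'] at hlogle
      exact div_le_div_of_nonneg_right hlogle hlog.le
  -- Step C: rotate to the axis half-plane (S5 fed with S6)
  have h₅' : Tendsto (fun n : ℕ ↦ (Real.log (diagArm n) - Real.log (axisArm n)) / Real.log n) atTop
      (𝓝 0) := h₅ h₆
  have hC := hB.sub h₅'
  rw [sub_zero] at hC
  refine hC.congr' ?_
  filter_upwards [eventually_ge_atTop 2] with n hn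
  have hn' : (2 : ℝ) ≤ n := by exact_mod_cast hn
  have hlog : Real.log n ≠ 0 := (Real.log_pos (by linarith)).ne'
  field_simp
  ring

/-- The closed form over the seven registered stubs (an `example`, so that `HalfPlaneOneArmThird_of`
stays the only theorem of the file concluding the crux). -/
example : Summit.CriticalPhenomena.CardyFormulaZ2.Theses.CardyBoundaryCoulombGas.HalfPlaneOneArmThird :=
  HalfPlaneOneArmThird_of stub_ipRecursion_of_ikhlefPonsaing stub_ikhlefPonsaingFirstPassage
    stub_recursionExponent stub_passageLeArm stub_armLePassage stub_rotationTransfer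
    stub_dkkmoRotationInvariance

end Summit.CriticalPhenomena.CardyFormulaZ2.Cruxes.HalfPlaneOneArmThird.IpPassageStirling

end
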